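import Summits.AnomalousDissipation.AnomalousDissipation.Theses.EulerLimit

/-!
# Redirect r1 (crux-strategist) — `VanishingViscosityRealizationV2` (stmt-AnomalousDissipation-1507)

Kernel-checked record for STRATEGY-CENSUS.md (`strategy: no-strategy`).

The "costume theorem": modulo the route's OWN elementary assembly item `Assembly4`
(stmt-AnomalousDissipation-0523 : named facts → X → ZerothLaw, which `closes` consumes anyway and
whose three named-fact antecedents are discharged in Literature), the crux V2 ALONE decides the
summit — `v2_imp_summit_of_assembly4` below is literally `closes` with V2 projected into the X slot.
So V2 ⟹ X ⟹ S along the route's designed chain: V2 is a formal STRENGTHENING of the thesis X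
(= BV2020 §8 last problem / BDL2023 Q.1), not a weaker statement; the converse S → V2 is not
derivable (S carries no periodicity / Euler-limit / Hölder / defect-sign content), and no
separating witness (a model deciding V2's analogue but not S's) was found — see the census.

Mechanical probes (folder bc/, farm 2026-08-17): C → S 5/5 one-tactic batteries FAIL, S → C 5/5
FAIL, `#h21_crux_probe` VERDICT CLEAN — i.e. the implication is not *cheap* (it needs the ~150-line
measure-theoretic Assembly4), but it is the route's own glue, not new mathematics.

No `sorry`, no new axioms.
-/

set_option linter.dupNamespace false

namespace Summit.AnomalousDissipation.AnomalousDissipation.Cruxes.VanishingViscosityRealizationV2.RedirectR1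

open Summit.AnomalousDissipation.AnomalousDissipation.Theses.EulerLimit

/-- Projection V2 → X (forget the Hölder and Duchon–Robert conjuncts); re-proves the refuter's
`Refuter1507.v2_imp_thesis` (Evidence1507.lean) so this file is self-contained. -/
theorem v2_imp_thesis : VanishingViscosityRealizationV2 → EulerlimitThesisV2 := by
  rintro ⟨f, hf₁, hf₂, hf₃, τ, u, hτ, hper, _hHolder, hweak, hinput, _hDR, ν, us, ps, hν, hν₀, hcl, hL3⟩
  exact ⟨f, hf₁, hf₂, hf₃, τ, u, hτ, hper, hweak, hinput, ν, us, ps, hν, hν₀, hcl, hL3⟩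

/-- Projection V2 → the existence crux (stmt-1516): forget the realising family. -/
theorem v2_imp_existence :
    VanishingViscosityRealizationV2 → GloballyDissipativePeriodicEulerFlow := by
  rintro ⟨f, hf₁, hf₂, hf₃, τ, u, hτ, hper, hHolder, hweak, hinput, hDR, _ν, _us, _ps, _hν, _hν₀, _hcl, _hL3⟩
  exact ⟨f, hf₁, hf₂, hf₃, τ, u, hτ, hper, hHolder, hweak, hinput, hDR⟩

/-- The glue item `RealizationGivesThesis` (stmt-1754) holds outright. -/
theorem realizationGivesThesis_holds : RealizationGivesThesis := v2_imp_thesis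

/-- V2 is exactly "X-witness that is moreover Hölder with a signed defect": the joint form. -/
theorem v2_imp_joint :
    VanishingViscosityRealizationV2 → EulerlimitThesisV2 ∧ GloballyDissipativePeriodicEulerFlow :=
  fun h => ⟨v2_imp_thesis h, v2_imp_existence h⟩

/-- COSTUME THEOREM. Modulo the route's own elementary assembly item `Assembly4` (stmt-0523),
the crux V2 alone gives the summit: this is `closes` with `v2_imp_thesis hV` in the X slot. -/
theorem v2_imp_summit_of_assembly4 (hA : Assembly4) :
    VanishingViscosityRealizationV2 → _root_.AnomalousDissipation :=
  fun hV => closes (v2_imp_thesis hV) hV (v2_imp_existence hV) realizationGivesThesis_holds hA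

/-- Same statement, proved directly through `Assembly4` without `closes` (shows which Literature
facts the chain uses: all three antecedents of `Assembly4` are discharged theorems). -/
theorem v2_imp_summit_of_assembly4' (hA : Assembly4) :
    VanishingViscosityRealizationV2 → _root_.AnomalousDissipation :=
  fun hV => hA Literature.Analysis.FunctionSpaces.Torus.IsClassicalNSSolutionOn.energy_balance_holds
    Literature.Analysis.FunctionSpaces.Torus.gradNormSq_eq_toReal_eGradNormSq_holds
    Literature.Analysis.FluidPDE.Torus.isGlobalLerayHopf_of_isClassicalNSSolutionOn_holds
    (v2_imp_thesis hV)

/-- `closes` never consumes V2: X and `Assembly4` alone reach the summit (cone.binder_used =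
[EulerlimitThesisV2, Assembly4]); V2 enters the route only through `v2_imp_thesis`. -/
theorem summit_of_thesis_and_assembly4 (hX : EulerlimitThesisV2) (hA : Assembly4) :
    _root_.AnomalousDissipation :=
  hA Literature.Analysis.FunctionSpaces.Torus.IsClassicalNSSolutionOn.energy_balance_holds
    Literature.Analysis.FunctionSpaces.Torus.gradNormSq_eq_toReal_eGradNormSq_holds
    Literature.Analysis.FluidPDE.Torus.isGlobalLerayHopf_of_isClassicalNSSolutionOn_holds hX

#print axioms v2_imp_summit_of_assembly4

end Summit.AnomalousDissipation.AnomalousDissipation.Cruxes.VanishingViscosityRealizationV2.RedirectR1
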